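import Summits.QuantumFields.BalabanUV.Beta.GAN24.CombTransportZeroMode
import Summits.QuantumFields.BalabanUV.Beta.GAN24.TableDressingZeroMode

/-!
# `BalabanUV.Beta.GAN24.SymCorrectorExitFace` — binder row G-an2-4 ∕ (CONV-C), TRANSFER-III (the (α-0) chain at row D1's literal of record (III′)), the (C)-row at the comb
# data, a THIRD structural letter beyond the OWNER gan24-p1 g50's memo `C-ROW-AT-COMB-SIZING-g50.md` §2: **THE SYMMETRISED CORRECTOR IS THE IDENTITY ON EXIT BONDS, SO THE
# FOUR-FACE CHARGE — hence the field–field charge of the LEG-DRESSED table `𝔇_ρ` — IS BLIND TO THE FOUR-SLOT TRANSPORT `𝒯₄`**: `zmode n (𝔇_ρ (𝒯₄ Y)) = zmode n (𝔇_ρ Y)`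
# (ff block) for every `LocStencil₂` jointly `n`-covariant table and any in-block dressing root; at the comb data, with MY `SymCorrectorZeroMode` ∕ `CombTransportZeroMode`
# (`zmode (𝒯₄ T̃′♮_j) = zmode T̃′♮_j`), the corrector `Ψ̂_S` DISAPPEARS from the one-step charge law of the comb-chart `T₂` tower: the OWNER g51's `CombT2RecChargeStep` §3
# reads `zmodeSym_N (σ′_j) = zmodeSym_N (b̃′♮_j) − 2λ̂·[zmodeSym_Lc (T̃′♮_j) − zmodeSym_Lc (𝔇_{ρ_c} T̃′♮_j)]` — road-P2's (E) law `T2RecChargeStep.zmodeSym_sourceB_eq` VERBATIM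
# with the (E) member replaced by the (III′) member (the by-value face is Engine C's E0 (X) rows «sh+root = bm+root», «bm+sym = sh+sym», ccons/E0.md §2).

NOT IN PRINT; OUR BOOKKEEPING (G-an2-4 crux team (2), leaf prover `b2b-balaban-gan24-formalise-leaf-01`, gen 84; [folklore] bookkeeping BY NAME over d1-formalise-leaf-03's TT3a∕TT3b
`SymCorrectorFace.faceWt_eq_zero_of_blk_ne ∕ slotPsiS`, `SymCorrectorSlot.comp_trK_psiKS_inl_left ∕ comp_psiKS_inl_right`, leaf-02 g52's `TableDressingZeroMode.zmode_tableDress_ff`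
(«`zmode N (𝔇 Y) = N⁴ · fourFace_N (Y)`»), MY `CombTransportZeroMode.locStencil₂_fourSlot ∕ fourSlot_translate` and the comb-member letters `CombRelSourceHalfCharge.locStencil₂_unitS₂_T2RecOf_comb`
∕ `CombT2DriftEvenEnd.unitS₂_T2RecOf_comb_translate`; generic `d`, `0 < n`, `r ∈ box (d+1) n`; 0 `def`, 0 cited facts, 0 `def … : Prop`, 0 sorry).  HONEST FRAMING (cell contract, verbatim):
«discharging `BetaPertH` makes Bałaban's UV stability UNCONDITIONAL — a real constructive-QFT result; it is NOT the continuum limit and NOT the Clay problem.»  HONEST DEPENDENCY (verbatim):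
«continuum YM on T⁴ ⇐ BetaPertH ∧ nine spine estimates (0/9 proved); BetaPertH ⇐ (D1) ∧ (D4) ∧ CAP+tail; G-an2-4 gates asym, D1 and NE2/3/4.»

HOW ([folklore]).  A slot bond `(ν, u)` with `u_ν % n = n − 1` LEAVES its block (`blk n (u + e_ν) ≠ blk n u`), so its face weight vanishes (TT3a) and `slotPsiS r n T ν u = T ν u`; the leg
correctors are slot transports of the leg families (TT3b), so they too are the identity at exit legs.  The four-face functional reads all four positions through exit-face indicators —
on those configurations `𝒯₄ T = T` entrywise.

WHAT (`𝒯₄ T κ₁ u₁ κ₂ u₂ := Ψ̂ᵀ ∘ slotPsiS r n (slotPsiS r n T κ₁ u₁) κ₂ u₂ ∘ Ψ̂`, `Ψ̂ = psiKS r n`; `𝔇_ρ X := κ u κ′ u′ ↦ dressKBmAt ρ n (coProjBmAtK ρ n (κ₁ u₁ ↦ coProjBmAtK ρ n (X κ₁ u₁) κ′ u′)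
κ u)`, the lambda of leaf-06's `lin4_comb_coDressKBmAt` VERBATIM):
* §1 `blk_add_unitVec_ne_of_exitFace`; **`slotPsiS_eq_of_exitFace`** (module-valued), **`smul_slotPsiS_eq_of_faceSupported`** ∕ `mul_slotPsiS_eq_of_faceSupported` (weights `w` with `w m = 0` unless
  `m % n = n − 1`); **`comp_trK_psiKS_eq_of_exitFace`**, **`comp_psiKS_eq_of_exitFace`** (the leg correctors at exit legs).
* §2 **`fourSlot_apply_of_exitFace`** (`𝒯₄ T = T` entrywise on four-face configurations — ANY table); **`fourFace_fourSlot_eq`** (the four-face charge of `𝒯₄ T` is that of `T`, summand by summand).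
* §2b (the OWNER g51's W-2, deep periods `P` with `n ∣ P`) `exitFace_of_dvd`, `fourSlot_apply_of_exitFace_dvd`, **`fourFace_fourSlot_eq_of_dvd`** (`FF_P (𝒯₄ T) = FF_P (T)`), `translate_of_dvd`,
  **`zmode_tableDress_fourSlot_eq_of_dvd`** (`zmode P (𝔇^{(P)}_ρ (𝒯₄ Y)) = zmode P (𝔇^{(P)}_ρ Y)`, ff).
* §3 **`zmode_tableDress_fourSlot_eq`**: `zmode n (𝔇_ρ (𝒯₄ Y)) κ κ′ (inl a) (inl b) = zmode n (𝔇_ρ Y) κ κ′ (inl a) (inl b)` (`LocStencil₂` jointly `n`-covariant `Y`, any in-block `ρ`).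
* §4 (comb data) **`zmode_tableDress_fourSlot_comb_member_eq`**: the same for `Y = T̃′♮_j`, `Ψ̂ = Ψ̂_S`, `ρ = ρ_c`, every `j`, ANY `tabs`.
WHAT THIS IS NOT.  Asserts NO value of Bałaban's tables and NO value of any charge; does NOT remove the chart from the FORCING `b̃′♮_j` (its words read `G′ = GcombSh` and the sym tables —
the VALUE files ∕ engine E1–E2); NOT (d′)∕(d″); the (III′) campaign is NOT asked (an2 W-4) — zero weight; NEVER «G-an2-4 closed» as (CONV-C); NOT D1, NOT `BetaPertH`, NOT continuum,
NOT Clay; not in print.  `bears_on: R4-G`.  2026-08-27.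
-/

noncomputable section

open Finset
open scoped BigOperators
open Literature.MathematicalPhysics.QuantumFieldTheory
open Literature.MathematicalPhysics.QuantumFieldTheory.Balaban1983to89
open Literature.MathematicalPhysics.QuantumFieldTheory.Balaban1983to89.Beta
open ExpKernelCalculus (MKer BiLoc comp shiftK)
open OneStepResolventKernel (Fib)
open OneStepKernelFamily (KInvStep)
open AffineAveraging (Site Form1 box toSite unitVec unitVec_apply)
open AveragingContours (blk)
open AveragingContoursRooted (ctr ctrOff ctrOff_mem_box)
open BalabanCompositeJets (LocStencil₂)
open Summit.QuantumFields.BalabanUV.Beta.TameKernelCalculus (trK)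
open Summit.QuantumFields.BalabanUV.Beta.HessKerDressedUnits (unitK)
open Summit.QuantumFields.BalabanUV.Beta.SecondOrderUnits (unitS₂)
open Summit.QuantumFields.BalabanUV.Beta.AxialDressingRooted (coProjBmAtK dressKBmAt)
open Summit.QuantumFields.BalabanUV.Beta.SpineRooted (T2RecOf)
open Summit.QuantumFields.BalabanUV.Beta.SymmetrisedStepJets (SymTables)
open Summit.QuantumFields.BalabanUV.Beta.CombChartStepJets (GcombSh SpureCombOf)
open Summit.QuantumFields.BalabanUV.Beta.SymCorrectorKernel (psiKS)
open Summit.QuantumFields.BalabanUV.Beta.SymCorrectorFace (faceWt faceWt_eq_zero_of_blk_ne faceSum slotPsiS)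
open Summit.QuantumFields.BalabanUV.Beta.SymCorrectorSlot (comp_trK_psiKS_inl_left comp_psiKS_inl_right)
open Summit.QuantumFields.BalabanUV.Beta.GAN24.CombesThomas (sfStep smStep)
open Summit.QuantumFields.BalabanUV.Beta.GAN24.BiStencilZeroMode (Tab zmode)
open Summit.QuantumFields.BalabanUV.Beta.GAN24.TableDressingZeroMode (zmode_tableDress_ff)
open Summit.QuantumFields.BalabanUV.Beta.GAN24.CombRelSourceHalfCharge (locStencil₂_unitS₂_T2RecOf_comb)
open Summit.QuantumFields.BalabanUV.Beta.GAN24.CombT2DriftEvenEnd (unitS₂_T2RecOf_comb_translate)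
open Summit.QuantumFields.BalabanUV.Beta.GAN24.CombTransportZeroMode (fourSlot_translate locStencil₂_fourSlot pos_of_neZero)

namespace Summit.QuantumFields.BalabanUV.Beta.GAN24.SymCorrectorExitFace

variable {d : ℕ} {n : ℕ} (hn : 0 < n)
include hn

/-! ## §1 Exit bonds: the slot transport and the leg correctors are the identity there -/

/-- [folklore] **AN EXIT BOND CROSSES A FACE**: `u_ν % n = n − 1 ⟹ blk n (u + e_ν) ≠ blk n u` (the `ν`-th block index steps by one). -/
theorem blk_add_unitVec_ne_of_exitFace {u : Site (d + 1)} {ν : Fin (d + 1)} (hx : u ν % (n : ℤ) = (n : ℤ) - 1) : blk n (u + unitVec ν) ≠ blk n u := by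
  intro h
  have hν := congrFun h ν
  simp only [AveragingContours.blk, Pi.add_apply, unitVec_apply, if_true] at hν
  have hn0 : (n : ℤ) ≠ 0 := by exact_mod_cast hn.ne'
  have hdiv := Int.emod_add_mul_ediv (u ν) (n : ℤ)   -- u ν % n + n * (u ν / n) = u ν
  have e : u ν + 1 = (n : ℤ) * (u ν / (n : ℤ) + 1) := by rw [mul_add, mul_one]; linarith
  rw [e, Int.mul_ediv_cancel_left _ hn0] at hν
  linarith

variable {r : Fin (d + 1) → ℕ} (hr : r ∈ box (d + 1) n)
include hr

/-- [folklore] **THE SLOT TRANSPORT DOES NOT TOUCH EXIT BONDS**: `u_ν % n = n − 1 ⟹ slotPsiS r n T ν u = T ν u` (module-valued families; a face-CROSSING slot bond carries no face weight,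
TT3a `faceWt_eq_zero_of_blk_ne`). -/
theorem slotPsiS_eq_of_exitFace {E : Type*} [AddCommGroup E] [Module ℝ E] (T : Fin (d + 1) → Site (d + 1) → E) {ν : Fin (d + 1)} {u : Site (d + 1)}
    (hx : u ν % (n : ℤ) = (n : ℤ) - 1) : slotPsiS r n T ν u = T ν u := by
  show T ν u + faceWt r n ν u • faceSum n T (blk n u) = T ν u
  rw [faceWt_eq_zero_of_blk_ne hn hr (blk_add_unitVec_ne_of_exitFace hn hx), zero_smul, add_zero]

/-- [folklore] **EXIT-FACE-SUPPORTED SLOT WEIGHTS ARE BLIND TO THE SLOT TRANSPORT**: for a weight `w` with `w m = 0` unless `m % n = n − 1` (face indicators; the class data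
`c + dΨ` of the current-symmetry towers), `w (u_ν) • slotPsiS r n T ν u = w (u_ν) • T ν u`. -/
theorem smul_slotPsiS_eq_of_faceSupported {E : Type*} [AddCommGroup E] [Module ℝ E] {w : ℤ → ℝ} (hw : ∀ m : ℤ, m % (n : ℤ) ≠ (n : ℤ) - 1 → w m = 0)
    (T : Fin (d + 1) → Site (d + 1) → E) (ν : Fin (d + 1)) (u : Site (d + 1)) : w (u ν) • slotPsiS r n T ν u = w (u ν) • T ν u := by
  by_cases hx : u ν % (n : ℤ) = (n : ℤ) - 1
  · rw [slotPsiS_eq_of_exitFace hn hr T hx]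
  · rw [hw _ hx, zero_smul, zero_smul]

/-- [folklore] Scalar form: `w (u_ν) · slotPsiS r n F ν u = w (u_ν) · F ν u`. -/
theorem mul_slotPsiS_eq_of_faceSupported {w : ℤ → ℝ} (hw : ∀ m : ℤ, m % (n : ℤ) ≠ (n : ℤ) - 1 → w m = 0) (F : Form1 (d + 1) ℝ) (ν : Fin (d + 1)) (u : Site (d + 1)) :
    w (u ν) * slotPsiS r n F ν u = w (u ν) * F ν u := by
  have h := smul_slotPsiS_eq_of_faceSupported hn hr hw F ν u
  simpa only [smul_eq_mul] using h

/-- [folklore] **THE LEFT LEG CORRECTOR IS THE IDENTITY AT AN EXIT LEFT LEG**: `x_a % n = n − 1 ⟹ (Ψ̂ᵀ ∘ X)(x, z)_{inl a, b} = X(x, z)_{inl a, b}` (TT3b `comp_trK_psiKS_inl_left`). -/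
theorem comp_trK_psiKS_eq_of_exitFace (X : MKer (d + 1) (Fib d)) {x : Site (d + 1)} {a : Fin (d + 1)} (hx : x a % (n : ℤ) = (n : ℤ) - 1) (z : Site (d + 1)) (b : Fib d) :
    comp (trK (psiKS r n)) X x z (Sum.inl a) b = X x z (Sum.inl a) b := by
  rw [comp_trK_psiKS_inl_left hn hr, slotPsiS_eq_of_exitFace hn hr _ hx]

/-- [folklore] **THE RIGHT LEG CORRECTOR IS THE IDENTITY AT AN EXIT RIGHT LEG**: `z_b % n = n − 1 ⟹ (X ∘ Ψ̂)(x, z)_{a, inl b} = X(x, z)_{a, inl b}` (TT3b `comp_psiKS_inl_right`). -/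
theorem comp_psiKS_eq_of_exitFace (X : MKer (d + 1) (Fib d)) (x : Site (d + 1)) (a : Fib d) {z : Site (d + 1)} {b : Fin (d + 1)} (hz : z b % (n : ℤ) = (n : ℤ) - 1) :
    comp X (psiKS r n) x z a (Sum.inl b) = X x z a (Sum.inl b) := by
  rw [comp_psiKS_inl_right hn hr, slotPsiS_eq_of_exitFace hn hr _ hz]

/-! ## §2 The four-slot transport is the identity on four-face configurations; the four-face charge is blind to it -/

variable (T : Fin (d + 1) → Site (d + 1) → Fin (d + 1) → Site (d + 1) → MKer (d + 1) (Fib d))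

/-- **`𝒯₄` IS THE IDENTITY ON FOUR-FACE CONFIGURATIONS** [our bookkeeping; folklore composition] (ANY table, no hypothesis): if both slot bonds and both field legs sit on exit
faces of their own directions (`u_κ, u′_{κ′}, x_a, z_b ≡ n − 1 (mod n)`), then `𝒯₄ T κ u κ′ u′ x z (inl a) (inl b) = T κ u κ′ u′ x z (inl a) (inl b)`. -/
theorem fourSlot_apply_of_exitFace {κ : Fin (d + 1)} {u : Site (d + 1)} {κ' : Fin (d + 1)} {u' x z : Site (d + 1)} {a b : Fin (d + 1)}
    (hu : u κ % (n : ℤ) = (n : ℤ) - 1) (hu' : u' κ' % (n : ℤ) = (n : ℤ) - 1) (hx : x a % (n : ℤ) = (n : ℤ) - 1) (hz : z b % (n : ℤ) = (n : ℤ) - 1) :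
    comp (comp (trK (psiKS r n)) (slotPsiS r n (slotPsiS r n T κ u) κ' u')) (psiKS r n) x z (Sum.inl a) (Sum.inl b) = T κ u κ' u' x z (Sum.inl a) (Sum.inl b) := by
  rw [comp_psiKS_eq_of_exitFace hn hr _ x _ hz, comp_trK_psiKS_eq_of_exitFace hn hr _ hx, slotPsiS_eq_of_exitFace hn hr _ hu',
    slotPsiS_eq_of_exitFace hn hr _ hu]

/-- **THE FOUR-FACE CHARGE IS BLIND TO `𝒯₄`** [our bookkeeping; folklore composition] (ANY table, every period-`n` cell, no hypothesis): the four-face functional of leaf-02 g52's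
`TableDressingZeroMode.zmode_tableDress_ff` (first slot over one cell, second slot and both legs over the lattice, all four read through the exit-face indicators) takes the same
value on `𝒯₄ T` and on `T` — summand by summand. -/
theorem fourFace_fourSlot_eq (κ κ' a b : Fin (d + 1)) :
    (∑ c ∈ box (d + 1) n, ∑' u' : Site (d + 1), ∑' x : Site (d + 1), ∑' z : Site (d + 1),
        (if toSite c κ % (n : ℤ) = (n : ℤ) - 1 ∧ u' κ' % (n : ℤ) = (n : ℤ) - 1 ∧ x a % (n : ℤ) = (n : ℤ) - 1 ∧ z b % (n : ℤ) = (n : ℤ) - 1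
          then comp (comp (trK (psiKS r n)) (slotPsiS r n (slotPsiS r n T κ (toSite c)) κ' u')) (psiKS r n) x z (Sum.inl a) (Sum.inl b) else 0))
      = ∑ c ∈ box (d + 1) n, ∑' u' : Site (d + 1), ∑' x : Site (d + 1), ∑' z : Site (d + 1),
        (if toSite c κ % (n : ℤ) = (n : ℤ) - 1 ∧ u' κ' % (n : ℤ) = (n : ℤ) - 1 ∧ x a % (n : ℤ) = (n : ℤ) - 1 ∧ z b % (n : ℤ) = (n : ℤ) - 1
          then T κ (toSite c) κ' u' x z (Sum.inl a) (Sum.inl b) else 0) := by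
  refine Finset.sum_congr rfl fun c _ => tsum_congr fun u' => tsum_congr fun x => tsum_congr fun z => ?_
  by_cases h : toSite c κ % (n : ℤ) = (n : ℤ) - 1 ∧ u' κ' % (n : ℤ) = (n : ℤ) - 1 ∧ x a % (n : ℤ) = (n : ℤ) - 1 ∧ z b % (n : ℤ) = (n : ℤ) - 1
  · rw [if_pos h, if_pos h, fourSlot_apply_of_exitFace hn hr T h.1 h.2.1 h.2.2.1 h.2.2.2]
  · rw [if_neg h, if_neg h]

/-! ### §2b Deep periods `P` with `n ∣ P` (the OWNER gan24-p1 g51's W-2 ask, for road-P2's face-read tower `FF_{P_m}`, `P_m = Lc^{m+1}`) -/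

omit hr in
/-- [folklore] **AN EXIT FACE AT A COARSER PERIOD IS AN EXIT FACE**: for `n ∣ P`, `m % P = P − 1 ⟹ m % n = n − 1`. -/
theorem exitFace_of_dvd {P : ℕ} (hdvd : n ∣ P) {m : ℤ} (hm : m % (P : ℤ) = (P : ℤ) - 1) : m % (n : ℤ) = (n : ℤ) - 1 := by
  obtain ⟨k, hk⟩ := hdvd
  have hn0 : (0 : ℤ) < n := by exact_mod_cast hn
  have hdvd' : (n : ℤ) ∣ (P : ℤ) := ⟨k, by exact_mod_cast hk⟩
  rw [← Int.emod_emod_of_dvd m hdvd', hm, show (P : ℤ) - 1 = ((n : ℤ) - 1) + (n : ℤ) * ((k : ℤ) - 1) by push_cast [hk]; ring,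
    Int.add_mul_emod_self_left]
  exact Int.emod_eq_of_lt (by linarith) (by linarith)

/-- [folklore] **`𝒯₄` IS THE IDENTITY ON FOUR-FACE CONFIGURATIONS OF EVERY PERIOD `P` WITH `n ∣ P`** (ANY table). -/
theorem fourSlot_apply_of_exitFace_dvd {P : ℕ} (hdvd : n ∣ P) {κ : Fin (d + 1)} {u : Site (d + 1)} {κ' : Fin (d + 1)} {u' x z : Site (d + 1)} {a b : Fin (d + 1)}
    (hu : u κ % (P : ℤ) = (P : ℤ) - 1) (hu' : u' κ' % (P : ℤ) = (P : ℤ) - 1) (hx : x a % (P : ℤ) = (P : ℤ) - 1) (hz : z b % (P : ℤ) = (P : ℤ) - 1) :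
    comp (comp (trK (psiKS r n)) (slotPsiS r n (slotPsiS r n T κ u) κ' u')) (psiKS r n) x z (Sum.inl a) (Sum.inl b) = T κ u κ' u' x z (Sum.inl a) (Sum.inl b) :=
  fourSlot_apply_of_exitFace hn hr T (exitFace_of_dvd hn hdvd hu) (exitFace_of_dvd hn hdvd hu') (exitFace_of_dvd hn hdvd hx) (exitFace_of_dvd hn hdvd hz)

/-- **THE PERIOD-`P` FOUR-FACE CHARGE IS BLIND TO `𝒯₄` FOR EVERY `P` WITH `n ∣ P`** [our bookkeeping; folklore composition] (ANY table; road-P2's `CombChargeTowerStepDeepRows` currency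
`box (d+1) P`, residues `mod P` — the deep face reads `FF_{P_m}`, `P_m = Lc^{m+1}`, of the OWNER's two-index pair-form tower at the comb data). -/
theorem fourFace_fourSlot_eq_of_dvd {P : ℕ} (hdvd : n ∣ P) (κ κ' a b : Fin (d + 1)) :
    (∑ c ∈ box (d + 1) P, ∑' u' : Site (d + 1), ∑' x : Site (d + 1), ∑' z : Site (d + 1),
        (if toSite c κ % (P : ℤ) = (P : ℤ) - 1 ∧ u' κ' % (P : ℤ) = (P : ℤ) - 1 ∧ x a % (P : ℤ) = (P : ℤ) - 1 ∧ z b % (P : ℤ) = (P : ℤ) - 1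
          then comp (comp (trK (psiKS r n)) (slotPsiS r n (slotPsiS r n T κ (toSite c)) κ' u')) (psiKS r n) x z (Sum.inl a) (Sum.inl b) else 0))
      = ∑ c ∈ box (d + 1) P, ∑' u' : Site (d + 1), ∑' x : Site (d + 1), ∑' z : Site (d + 1),
        (if toSite c κ % (P : ℤ) = (P : ℤ) - 1 ∧ u' κ' % (P : ℤ) = (P : ℤ) - 1 ∧ x a % (P : ℤ) = (P : ℤ) - 1 ∧ z b % (P : ℤ) = (P : ℤ) - 1
          then T κ (toSite c) κ' u' x z (Sum.inl a) (Sum.inl b) else 0) := by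
  refine Finset.sum_congr rfl fun c _ => tsum_congr fun u' => tsum_congr fun x => tsum_congr fun z => ?_
  by_cases h : toSite c κ % (P : ℤ) = (P : ℤ) - 1 ∧ u' κ' % (P : ℤ) = (P : ℤ) - 1 ∧ x a % (P : ℤ) = (P : ℤ) - 1 ∧ z b % (P : ℤ) = (P : ℤ) - 1
  · rw [if_pos h, if_pos h, fourSlot_apply_of_exitFace_dvd hn hr T hdvd h.1 h.2.1 h.2.2.1 h.2.2.2]
  · rw [if_neg h, if_neg h]

omit hn hr in
/-- [folklore] **JOINT `n`-COVARIANCE IMPLIES JOINT `P`-COVARIANCE FOR `n ∣ P`.** -/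
theorem translate_of_dvd {P : ℕ} (hdvd : n ∣ P) {Y : Tab d}
    (hcov : ∀ κ u κ' u' t, Y κ (u + (n : ℤ) • t) κ' (u' + (n : ℤ) • t) = shiftK (-((n : ℤ) • t)) (Y κ u κ' u'))
    (κ : Fin (d + 1)) (u : Site (d + 1)) (κ' : Fin (d + 1)) (u' t : Site (d + 1)) :
    Y κ (u + (P : ℤ) • t) κ' (u' + (P : ℤ) • t) = shiftK (-((P : ℤ) • t)) (Y κ u κ' u') := by
  obtain ⟨k, hk⟩ := hdvd
  have e : (P : ℤ) • t = (n : ℤ) • ((k : ℤ) • t) := by rw [smul_smul, hk]; push_cast; rfl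
  rw [e, hcov]

/-- **THE PERIOD-`P` DRESSED CHARGE IS BLIND TO `𝒯₄` FOR `n ∣ P`** [our bookkeeping; folklore composition]: with the leg-and-slot dressing `𝔇^{(P)}_ρ` at blocking `P` (in-block root
`ρ = toSite s`, `s ∈ box (d+1) P`), `zmode P (𝔇^{(P)}_ρ (𝒯₄ Y)) κ κ′ (inl a) (inl b) = zmode P (𝔇^{(P)}_ρ Y) κ κ′ (inl a) (inl b)` for every `LocStencil₂` jointly `n`-covariant `Y`. -/
theorem zmode_tableDress_fourSlot_eq_of_dvd {P : ℕ} (hP : 1 ≤ P) (hdvd : n ∣ P) {s : Fin (d + 1) → ℕ} (hs : s ∈ box (d + 1) P) {Y : Tab d} {C δ : ℝ}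
    (hY : LocStencil₂ Y C δ) (hδ : 0 < δ) (hcov : ∀ κ u κ' u' t, Y κ (u + (n : ℤ) • t) κ' (u' + (n : ℤ) • t) = shiftK (-((n : ℤ) • t)) (Y κ u κ' u'))
    (κ κ' a b : Fin (d + 1)) :
    zmode P (fun κ u κ' u' => dressKBmAt (toSite s) P (coProjBmAtK (toSite s) P (fun κ₁ u₁ => coProjBmAtK (toSite s) P
        ((fun κ₂ u₂ κ₃ u₃ => comp (comp (trK (psiKS r n)) (slotPsiS r n (slotPsiS r n Y κ₂ u₂) κ₃ u₃)) (psiKS r n)) κ₁ u₁) κ' u') κ u)) κ κ' (Sum.inl a) (Sum.inl b)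
      = zmode P (fun κ u κ' u' => dressKBmAt (toSite s) P (coProjBmAtK (toSite s) P (fun κ₁ u₁ => coProjBmAtK (toSite s) P (Y κ₁ u₁) κ' u') κ u))
          κ κ' (Sum.inl a) (Sum.inl b) := by
  obtain ⟨C', hY₄⟩ := locStencil₂_fourSlot hn hr hY hδ
  rw [zmode_tableDress_ff hP hs hY₄ (by positivity)
      (translate_of_dvd (Y := fun κ₂ u₂ κ₃ u₃ => comp (comp (trK (psiKS r n)) (slotPsiS r n (slotPsiS r n Y κ₂ u₂) κ₃ u₃)) (psiKS r n))
        hdvd (fourSlot_translate hn r hcov)) κ κ' a b,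
    zmode_tableDress_ff hP hs hY hδ (translate_of_dvd hdvd hcov) κ κ' a b, fourFace_fourSlot_eq_of_dvd hn hr Y hdvd κ κ' a b]

/-! ## §3 Hence the DRESSED charge is blind to `𝒯₄`: `zmode n (𝔇_ρ (𝒯₄ Y)) = zmode n (𝔇_ρ Y)` in the field–field block -/

/-- **THE FIELD–FIELD CHARGE OF THE LEG-DRESSED TRANSPORTED TABLE IS THAT OF THE LEG-DRESSED TABLE** [our bookkeeping; folklore composition]: for a `LocStencil₂` jointly `n`-covariant
table `Y` (rate `> 0`), ANY in-block dressing root `ρ = toSite s` (`s ∈ box (d+1) n`) and the corrector root `r`,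
`zmode n (𝔇_ρ (𝒯₄ Y)) κ κ′ (inl a) (inl b) = zmode n (𝔇_ρ Y) κ κ′ (inl a) (inl b)`, `𝔇_ρ X := κ u κ′ u′ ↦ dressKBmAt ρ n (coProjBmAtK ρ n (κ₁ u₁ ↦ coProjBmAtK ρ n (X κ₁ u₁) κ′ u′) κ u)`
— leaf-02 g52's `zmode_tableDress_ff` on both sides (`𝒯₄ Y` is `LocStencil₂` and jointly covariant by MY `CombTransportZeroMode.locStencil₂_fourSlot ∕ fourSlot_translate`) and §2. -/
theorem zmode_tableDress_fourSlot_eq {s : Fin (d + 1) → ℕ} (hs : s ∈ box (d + 1) n) {Y : Tab d} {C δ : ℝ} (hY : LocStencil₂ Y C δ) (hδ : 0 < δ)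
    (hcov : ∀ κ u κ' u' t, Y κ (u + (n : ℤ) • t) κ' (u' + (n : ℤ) • t) = shiftK (-((n : ℤ) • t)) (Y κ u κ' u')) (κ κ' a b : Fin (d + 1)) :
    zmode n (fun κ u κ' u' => dressKBmAt (toSite s) n (coProjBmAtK (toSite s) n (fun κ₁ u₁ => coProjBmAtK (toSite s) n
        ((fun κ₂ u₂ κ₃ u₃ => comp (comp (trK (psiKS r n)) (slotPsiS r n (slotPsiS r n Y κ₂ u₂) κ₃ u₃)) (psiKS r n)) κ₁ u₁) κ' u') κ u)) κ κ' (Sum.inl a) (Sum.inl b)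
      = zmode n (fun κ u κ' u' => dressKBmAt (toSite s) n (coProjBmAtK (toSite s) n (fun κ₁ u₁ => coProjBmAtK (toSite s) n (Y κ₁ u₁) κ' u') κ u))
          κ κ' (Sum.inl a) (Sum.inl b) := by
  obtain ⟨C', hY₄⟩ := locStencil₂_fourSlot hn hr hY hδ
  rw [zmode_tableDress_ff hn hs hY₄ (by positivity) (fourSlot_translate hn r hcov) κ κ' a b, zmode_tableDress_ff hn hs hY hδ hcov κ κ' a b,
    fourFace_fourSlot_eq hn hr Y κ κ' a b]

end Summit.QuantumFields.BalabanUV.Beta.GAN24.SymCorrectorExitFace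

/-! ## §4 At the comb data: the dressed charge of the transported comb-chart member is that of the member -/

namespace Summit.QuantumFields.BalabanUV.Beta.GAN24.SymCorrectorExitFace

variable {d : ℕ} {Lc : ℕ} [NeZero Lc]

/-- **THE DRESSED CHARGE OF THE TRANSPORTED COMB-CHART MEMBER IS THE DRESSED CHARGE OF THE MEMBER** [our bookkeeping; folklore composition]: for ANY sym record `tabs`, all constants,
every level `j`, `Ψ̂_S = psiKS (ctrOff (d+1) Lc) Lc`, dressing root `ρ_c = ctr (d+1) Lc`: `zmode Lc (𝔇_{ρ_c} (𝒯₄ T̃′♮_j)) κ κ′ (inl a) (inl b) = zmode Lc (𝔇_{ρ_c} T̃′♮_j) κ κ′ (inl a) (inl b)`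
— with MY `zmode_fourSlot_comb_member_eq` the corrector `Ψ̂_S` DISAPPEARS from the one-step charge law of the comb-chart `T₂` tower (the OWNER's `CombT2RecChargeStep` §3):
`zmodeSym_N (σ′_j) = zmodeSym_N (b̃′♮_j) − 2λ̂·[zmodeSym_Lc (T̃′♮_j) − zmodeSym_Lc (𝔇_{ρ_c} T̃′♮_j)]`, the (E) law VERBATIM with the (E) member replaced by the (III′) member. -/
theorem zmode_tableDress_fourSlot_comb_member_eq (tabs : SymTables d Lc) (cE cVH cΛ cE₂ cB : ℝ) (Tc : Fin 4 → Fin 4 → Fin 4 → Fin 4 → ℝ) (j : ℕ)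
    (κ κ' a b : Fin (d + 1)) :
    zmode Lc (fun κ u κ' u' => dressKBmAt (ctr (d + 1) Lc) Lc (coProjBmAtK (ctr (d + 1) Lc) Lc (fun κ₁ u₁ => coProjBmAtK (ctr (d + 1) Lc) Lc
        ((fun κ₂ u₂ κ₃ u₃ => comp (comp (trK (psiKS (ctrOff (d + 1) Lc) Lc))
          (slotPsiS (ctrOff (d + 1) Lc) Lc (slotPsiS (ctrOff (d + 1) Lc) Lc
            (unitS₂ (sfStep Lc j) (smStep d Lc j) (T2RecOf d Lc (GcombSh Lc) (SpureCombOf tabs cE cVH cΛ) tabs.M cE₂ cB Tc tabs.vh₂S tabs.mixFF j)) κ₂ u₂) κ₃ u₃))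
          (psiKS (ctrOff (d + 1) Lc) Lc)) κ₁ u₁) κ' u') κ u)) κ κ' (Sum.inl a) (Sum.inl b)
      = zmode Lc (fun κ u κ' u' => dressKBmAt (ctr (d + 1) Lc) Lc (coProjBmAtK (ctr (d + 1) Lc) Lc (fun κ₁ u₁ => coProjBmAtK (ctr (d + 1) Lc) Lc
          (unitS₂ (sfStep Lc j) (smStep d Lc j) (T2RecOf d Lc (GcombSh Lc) (SpureCombOf tabs cE cVH cΛ) tabs.M cE₂ cB Tc tabs.vh₂S tabs.mixFF j) κ₁ u₁) κ' u') κ u))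
          κ κ' (Sum.inl a) (Sum.inl b) := by
  obtain ⟨C, δ, hδ, hT⟩ := locStencil₂_unitS₂_T2RecOf_comb tabs cE cVH cΛ cE₂ cB Tc j
  exact zmode_tableDress_fourSlot_eq pos_of_neZero (ctrOff_mem_box pos_of_neZero) (ctrOff_mem_box pos_of_neZero) hT hδ
    (unitS₂_T2RecOf_comb_translate tabs cE cVH cΛ cE₂ cB Tc j) κ κ' a b

end Summit.QuantumFields.BalabanUV.Beta.GAN24.SymCorrectorExitFace

end
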